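import Literature.Geometry.Lorentzian.StationaryVacuumModuli
import Literature.Geometry.Lorentzian.TangentProfile
import Literature.Geometry.Lorentzian.KerrStationaryBlackHole
import HarnessLib

/-!
# The moduli space of regular stationary vacuum black holes, II: topology, Kerr locus

Second half of definition request `defn-StationaryVacuumModuli` (route
`FinalStateConjecture/SignedCensus`); part I (`StationaryVacuumModuli`) defines the points
(`StationaryAFBlackHole.IsRegularVacuum`), the equivalence (`ModuliEquivalence`), the quotient
`𝔐 = StationaryVacuumModuli` and the level map. Here: the requested TOPOLOGY ("`[𝓑ₙ] → [𝓑]` iff for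
an exhaustion of a `T`-invariant neighbourhood of a Cauchy slice collar through the horizon of `𝓑`
there are smooth embeddings `ψₙ : Kₙ → 𝓑ₙ` with `ψₙ^*(gₙ, Tₙ) → (g, T)` in `C^∞_loc`, plus uniform
control of the AF weighted norms of a fixed order along the ends; model: pointed `C^∞`
Cheeger–Gromov convergence") and the KERR LOCUS.

## Contents (namespace `Literature.Geometry.Lorentzian`)

* `Spacetime.fieldDeviation`, `Spacetime.fieldDeviationCk` — components, in a local
  parametrisation `χ : V → Z`, of `ƛ ψ^* Y − Y₀` for vector fields (companion of
  `Spacetime.blowupDeviation(Ck)` of `TangentProfile`, which handles `ƛ⁻² ψ^* g − g_Z`), and the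
  identities `…_id_one` (zero deviation along `id` at scale `1`).
* `AFEnd.ChartDecayWith h k α C R₀` — decay of order `α` with EXPLICIT constants for chart
  components; `AFEnd.rescaleChart ƛ p f` — components of homothetically rescaled data in the
  rescaled chart; `AFEnd.IsAsymptoticallyFlat.exists_chartDecayWith` — the big-`O` notion of
  `AsymptoticFlatness` has explicit constants (proved).
* `StationaryAFBlackHole.pastOfEnd/futureOfEnd` (`I^∓(M_ext)`, with `doc_eq`, `horizon_eq`,
  `blackHoleRegion_eq` by `rfl`).
* `StationaryAFBlackHole.ConvergenceData 𝓑s 𝓑`, `ConvergesTo 𝓑s 𝓑` — pointed `C^∞` Cheeger–Gromov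
  convergence modulo scale of a sequence of stationary black holes to `𝓑`: an open
  `T`-flow-invariant `W ⊇ ⟨⟨M_ext⟩⟩ ∪ 𝓔⁺` in the limit, scales `ƛₙ > 0`, maps `ψₙ : M → Mₙ` which
  near every compact subset of `W` are eventually time-oriented smooth open embeddings, with
  `ƛₙ⁻² ψₙ^* gₙ → g` and `ƛₙ ψₙ^* Tₙ → T` in every `Cᵏ` on compact subsets of local
  parametrisations of `W`, ANCHORED at the causal structure of the ends (pulled-back `I^∓(M_ext,ₙ)`
  converge to `I^∓(M_ext)` locally uniformly off their boundaries — so d.o.c.s, black-hole regions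
  and horizons correspond in the limit) and with UNIFORMLY asymptotically flat rescaled slice
  data of a fixed order; API `comp` (subsequences), `eventually_mem_doc`,
  `eventually_mem_blackHoleRegion`, and the sanity construction `ConvergenceData.const`
  (constant sequences converge; uses `exists_chartDecayWith`).
* `StationaryVacuumModuli.topologicalSpace` — THE TOPOLOGY of `𝔐`: the sequential topology
  generated by `ConvergesTo` on representatives (`isOpen_iff`, `isClosed_iff`,
  `tendsto_mk_of_convergesTo`).
* `StationaryVacuumModuli.IsKerrPoint m χ`, `kerrLocus`, `kerrRatioLevel χ = χ²/(1+√(1−χ²))²`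
  (`= a²/r₊²`, `kerrRatioLevel_eq`) — the Kerr curve `χ = a/M`.

## Design choices

* **Sequential topology.** The request specifies the topology by its convergent sequences; the
  finest topology with these convergent sequences is taken (open = eventually absorbs every
  sequence of classes whose representatives converge to a representative of a member). Testing
  ALL representatives makes the definition independent of any compatibility between `ConvergesTo`
  and `ModuliEquivalence` (which is therefore not postulated). Scales are explicit
  (`blowupDeviation` carries them) although, classes being homothety classes, scale `1` on
  suitable representatives would generate the same convergent sequences of classes.
* **`W` instead of an exhaustion**, and eventual embeddings near compact sets instead of
  embeddings of `Kₙ` (as in `Spacetime.BlowupSequence`): equivalent by a diagonal argument over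
  a compact exhaustion of the second-countable `W`, and free of partial functions.
* **`ψₙ^* Tₙ` literally**: vector fields are pulled back with `ContinuousLinearMap.inverse` of
  the differentials (honest on the eventual embeddings); given the metric convergence this is
  equivalent to convergence of the metric-dual covectors `gₙ(Tₙ, dψₙ ·)`.
* **Anchoring.** Un-anchored Cheeger–Gromov convergence of `(g, T)` on `W` would not relate the
  horizons/d.o.c.s of `𝓑ₙ` to those of `𝓑` (they are global causal objects); the four
  `eventually_mapsTo…` clauses are the black-hole analogue of the base points of pointed
  convergence (Anderson 2000, Lemma 1.3: "limit base point `x = lim xᵢ`"; Morgan–Tian Def. 5.3 (2))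
  and of the centring clauses of `Spacetime.BlowupSequence`, phrased with the open sets
  `I^∓(M_ext)` so that boundaries need only match in the limit.
* **Uniform AF control** is imposed on the RESCALED slice data of the representatives `𝓑ₙ` in
  their own (rescaled) end charts, with one order `α` and one pair of constants; the link between
  `ψₙ` and the end charts is only through the anchoring and the geometry (Bartnik's uniqueness of
  the structure at infinity), no chart-compatibility of `ψₙ` being imposed.
* **NOT asserted** (theorems about the notion, left to the route): that `level : 𝔐 → ℝ` is
  continuous or semicontinuous in this topology; that `𝔐` is Hausdorff; that limits are unique;
  that the Kerr fibres `{m | IsKerrPoint m χ}` are singletons (or nonempty: Kerr with a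
  horizon-crossing Cauchy slice being regular is the route's falsifier (i)); that
  `level = kerrRatioLevel χ` on them; compactness of sublevel sets (`ProperLevels`).
* `IsKerrPoint` quantifies the named fact `Kerr.isAsymptoticallyFlat_data` EXISTENTIALLY (with
  `[Kerr.Facts] [Kerr.SliceFacts]` as instance hypotheses, the house pattern of
  `Kerr.stationaryAFBlackHole`): were the fact false the locus would be empty, not everything.
* `set_option synthInstance.maxHeartbeats 200000`: instance search on the nested operator spaces
  `E3 →L[ℝ] E3 →L[ℝ] ℝ` of chart components is slow in manifold contexts (same setting as
  `AsymptoticFlatnessEnergy`).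

## References

* M. T. Anderson, *On stationary vacuum solutions to the Einstein equations*, Ann. Henri Poincaré
  1 (2000) 977–994, gr-qc/0001091, §1.3, Lemma 1.3 (key `Anderson2000`).
* M. T. Anderson, M. A. Khuri, arXiv:0909.4550 = Class. Quantum Grav. 30 (2013) 125005, §1, §3
  (key `AndersonKhuri2009`).
* J. Morgan, G. Tian, *Ricci flow and the Poincaré conjecture*, AMS/Clay 2007, Def. 5.3 (key
  `MorganTian2007`).
* R. Bartnik, *The mass of an asymptotically flat manifold*, CPAM 39 (1986), Def. 2.1 (key
  `Bartnik1986`).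
* M. Dafermos, I. Rodnianski, *Lectures on black holes and linear waves*, arXiv:0811.0354, §5.1
  (Kerr in ingoing coordinates; key `arXiv08110354`); B. O'Neill, *The geometry of Kerr black
  holes*, A K Peters 1995, Ch. 2.
* S. Alexakis, A. D. Ionescu, S. Klainerman, Duke Math. J. 163 (2014), arXiv:1304.0487, Thm. 1.1
  (key `AlexakisIonescuKlainerman2014`).
-/

noncomputable section

-- instance search on the nested operator spaces of the chart components (`E3 →L[ℝ] E3 →L[ℝ] ℝ`)
-- and of their `iteratedFDeriv`s is deep and slow in manifold contexts (as in
-- `AsymptoticFlatnessEnergy`, `AsymptoticallyFlatChart`)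
set_option synthInstance.maxHeartbeats 200000

open Bundle Set Manifold TopologicalSpace Filter Bornology Topology Asymptotics
open scoped ContDiff Manifold ENNReal

universe u v

namespace Literature.Geometry.Lorentzian

namespace Spacetime

variable {d : ℕ}

/-! ### The rescaled deviation of pulled-back vector fields in a local parametrisation -/

/-- The **rescaled deviation of a pulled-back vector field in a local parametrisation.** For
spacetimes `𝓢 = (M, g)`, `𝓩 = (Z, g_Z)` of dimension `d`, a map `ψ : Z → M`, a scale `ƛ`, vector
fields `Y` on `M` and `Y₀` on `Z`, and a local parametrisation `χ : V → Z` by an open `V ⊆ ℝᵈ`,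
the vector of `ℝᵈ`
`x ↦ ƛ · (d(ψ ∘ χ)_x)⁻¹ (Y (ψ (χ x))) − (dχ_x)⁻¹ (Y₀ (χ x)) = χ^*(ƛ ψ^* Y − Y₀)(x)`:
the coordinate components of the difference between the rescaled pulled-back field `ƛ ψ^* Y`
and `Y₀` (`ContinuousLinearMap.inverse` of the differentials, honest where `ψ ∘ χ` and `χ` are
local diffeomorphisms — the only case in which it is used; Mathlib's junk `0` otherwise). The
factor `ƛ` matches the metric rescaling `ƛ⁻² ψ^* g` of `Spacetime.blowupDeviation`: under
`g ↦ ƛ² g` a Killing field normalised at infinity rescales by `ƛ⁻¹`. Companion of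
`Spacetime.blowupDeviation` (`TangentProfile`); Morgan–Tian 2007, Def. 5.3 (convergence of
pulled-back tensors on an exhaustion). [cite: MorganTian2007, Def. 5.3] -/
def fieldDeviation (𝓢 : Spacetime.{u} d) (𝓩 : Spacetime.{v} d) (ψ : 𝓩.carrier → 𝓢.carrier)
    (lam : ℝ) (Y : Π p : 𝓢.carrier, TangentSpace (𝓡 d) p)
    (Y₀ : Π z : 𝓩.carrier, TangentSpace (𝓡 d) z) {V : Opens (EuclideanSpace ℝ (Fin d))}
    (χ : V → 𝓩.carrier) (x : V) : EuclideanSpace ℝ (Fin d) :=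
  lam • (mfderiv (𝓡 d) (𝓡 d) (ψ ∘ χ) x).inverse (Y (ψ (χ x))) -
    (mfderiv (𝓡 d) (𝓡 d) χ x).inverse (Y₀ (χ x))

/-- The `Cᵏ` size, on a compact coordinate patch `C ⊆ V`, of the rescaled field deviation: the
`Cᵏ` sup norm (`supCkENorm` of the extension by zero to `ℝᵈ`) over `C` of `fieldDeviation`; its
convergence to `0` for every `(V, χ, C, k)` is `C^∞_loc` convergence `ƛₙ ψₙ^* Yₙ → Y₀`
(Morgan–Tian 2007, Def. 5.3 (2a)). [cite: MorganTian2007, Def. 5.3] -/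
def fieldDeviationCk (𝓢 : Spacetime.{u} d) (𝓩 : Spacetime.{v} d) (ψ : 𝓩.carrier → 𝓢.carrier)
    (lam : ℝ) (Y : Π p : 𝓢.carrier, TangentSpace (𝓡 d) p)
    (Y₀ : Π z : 𝓩.carrier, TangentSpace (𝓡 d) z) {V : Opens (EuclideanSpace ℝ (Fin d))}
    (χ : V → 𝓩.carrier) (C : Set V) (k : ℕ) : ℝ≥0∞ :=
  supCkENorm (Subtype.val '' C) k
    (Function.extend Subtype.val (fieldDeviation 𝓢 𝓩 ψ lam Y Y₀ χ) 0)

/-- Along the identity at scale `1` the field deviation of a field from itself vanishes.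
[folklore] -/
@[simp]
theorem fieldDeviation_id_one (𝓢 : Spacetime.{u} d) (Y : Π p : 𝓢.carrier, TangentSpace (𝓡 d) p)
    {V : Opens (EuclideanSpace ℝ (Fin d))} (χ : V → 𝓢.carrier) :
    fieldDeviation 𝓢 𝓢 id 1 Y Y χ = 0 := by
  funext x
  simp only [fieldDeviation, one_smul, Pi.zero_apply]
  exact sub_self _

/-- Along the identity at scale `1` the `Cᵏ` field deviation vanishes. [folklore] -/
@[simp]
theorem fieldDeviationCk_id_one (𝓢 : Spacetime.{u} d) (Y : Π p : 𝓢.carrier, TangentSpace (𝓡 d) p)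
    {V : Opens (EuclideanSpace ℝ (Fin d))} (χ : V → 𝓢.carrier) (C : Set V) (k : ℕ) :
    fieldDeviationCk 𝓢 𝓢 id 1 Y Y χ C k = 0 := by
  rw [fieldDeviationCk, fieldDeviation_id_one, Function.extend_zero]
  exact supCkENorm_zero _ _

/-- Along the identity at scale `1` the metric deviation of a spacetime from itself vanishes.
[folklore] -/
@[simp]
theorem blowupDeviation_id_one (𝓢 : Spacetime.{u} d) {V : Opens (EuclideanSpace ℝ (Fin d))}
    (χ : V → 𝓢.carrier) : blowupDeviation 𝓢 𝓢 id 1 χ = 0 := by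
  funext x
  ext v w
  change (1 ^ 2 : ℝ)⁻¹ * 𝓢.metric.val (χ x) (mfderiv (𝓡 d) (𝓡 d) χ x v) (mfderiv (𝓡 d) (𝓡 d) χ x w) -
    𝓢.metric.val (χ x) (mfderiv (𝓡 d) (𝓡 d) χ x v) (mfderiv (𝓡 d) (𝓡 d) χ x w) = 0
  rw [one_pow, inv_one, one_mul, sub_self]

/-- Along the identity at scale `1` the `Cᵏ` metric deviation vanishes. [folklore] -/
@[simp]
theorem blowupDeviationCk_id_one (𝓢 : Spacetime.{u} d) {V : Opens (EuclideanSpace ℝ (Fin d))}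
    (χ : V → 𝓢.carrier) (C : Set V) (k : ℕ) : blowupDeviationCk 𝓢 𝓢 id 1 χ C k = 0 := by
  rw [blowupDeviationCk, blowupDeviation_id_one, Function.extend_zero]
  exact supCkENorm_zero _ _

end Spacetime

/-! ### Explicit-constant asymptotic flatness of chart components, and their rescaling -/

namespace AFEnd

/-- **Decay of order `α` with explicit constants** for chart components
`h, k : E3 → (E3 →L E3 →L ℝ)` of a metric and a second fundamental form:
`|∂^m (h − δ)(x)| ≤ C |x|^{−α−m}` for `m ≤ 2` and `|∂^m k(x)| ≤ C |x|^{−α−1−m}` for `m ≤ 1`,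
whenever `|x| ≥ R₀` (`iteratedFDeriv`; `δ = innerSL ℝ`). The explicit-constant ("uniform") form of
`AFEnd.IsAsymptoticallyFlat e D α` (which is this for `h = hCoeff e D`, `k = kCoeff e D`, SOME
`C, R₀`: `IsAsymptoticallyFlat.exists_chartDecayWith`), needed to say "uniformly in `n`".
Bartnik, CPAM 39 (1986), Def. 2.1. [cite: Bartnik1986, Def. 2.1] -/
def ChartDecayWith (h k : E3 → E3 →L[ℝ] E3 →L[ℝ] ℝ) (α C R₀ : ℝ) : Prop :=
  (∀ m : ℕ, m ≤ 2 → ∀ x : E3, R₀ ≤ ‖x‖ →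
      ‖iteratedFDeriv ℝ m (fun y ↦ h y - (innerSL ℝ : E3 →L[ℝ] E3 →L[ℝ] ℝ)) x‖ ≤
        C * ‖x‖ ^ (-α - m)) ∧
    ∀ m : ℕ, m ≤ 1 → ∀ x : E3, R₀ ≤ ‖x‖ → ‖iteratedFDeriv ℝ m k x‖ ≤ C * ‖x‖ ^ (-α - 1 - m)

/-- **Rescaled chart components.** Under the homothety `g ↦ ƛ⁻² g` of a spacetime the slice data
rescale to `(ƛ⁻² h, ƛ⁻¹ k)`, and in the rescaled end chart `x' = x/ƛ` (in which `ƛ⁻² h ≈ δ`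
again) their components are `h'_{ij}(x') = h_{ij}(ƛ x')`, `k'_{ij}(x') = ƛ k_{ij}(ƛ x')`:
`rescaleChart ƛ p f = fun x' ↦ ƛ ^ p • f (ƛ • x')` with weight `p = 0` for `h`, `p = 1` for `k`.
[folklore] -/
def rescaleChart (lam : ℝ) (p : ℕ) (f : E3 → E3 →L[ℝ] E3 →L[ℝ] ℝ) :
    E3 → E3 →L[ℝ] E3 →L[ℝ] ℝ :=
  fun x ↦ lam ^ p • f (lam • x)

/-- Rescaling by `ƛ = 1` does nothing. [folklore] -/
@[simp]
theorem rescaleChart_one (p : ℕ) (f : E3 → E3 →L[ℝ] E3 →L[ℝ] ℝ) : rescaleChart 1 p f = f := by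
  funext x
  simp [rescaleChart]

/-- Explicit-constant form of a big-`O` bound at infinity for a real-valued function on `E3`:
`f = O(|x|^p)` along `cobounded` gives `|f x| ≤ C |x|^p` for `|x| ≥ R`, some `C ≥ 0`.
[folklore] -/
theorem exists_bound_of_isBigO {f : E3 → ℝ} {p : ℝ}
    (hf : f =O[cobounded E3] fun x ↦ ‖x‖ ^ p) :
    ∃ C R : ℝ, 0 ≤ C ∧ ∀ x : E3, R ≤ ‖x‖ → ‖f x‖ ≤ C * ‖x‖ ^ p := by
  obtain ⟨C, hC0, hC⟩ := hf.exists_nonneg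
  obtain ⟨R, -, hR⟩ := (Filter.hasBasis_cobounded_norm (E := E3)).eventually_iff.1 hC.bound
  refine ⟨C, R, hC0, fun x hx ↦ ?_⟩
  have h := hR hx
  rwa [Real.norm_of_nonneg (Real.rpow_nonneg (norm_nonneg _) _)] at h

/-- **Asymptotic flatness of order `α` has explicit constants**: `IsAsymptoticallyFlat e D α`
(five big-`O` conditions along `cobounded E3`) yields `C` and `R₀ > max(R, 0)` with
`ChartDecayWith (hCoeff e D) (kCoeff e D) α C R₀`. Bartnik 1986, Def. 2.1. [cite: Bartnik1986, Def. 2.1] -/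
theorem IsAsymptoticallyFlat.exists_chartDecayWith {X : Type u} [TopologicalSpace X]
    [ChartedSpace E3 X] [IsManifold (𝓡 3) ∞ X] {e : AFEnd X} {D : InitialDataSet (𝓡 3) X}
    {α : ℝ} (h : e.IsAsymptoticallyFlat D α) :
    ∃ C R₀ : ℝ, e.R < R₀ ∧ 0 < R₀ ∧ ChartDecayWith (hCoeff e D) (kCoeff e D) α C R₀ := by
  obtain ⟨C₀, S₀, -, h₀⟩ := exists_bound_of_isBigO (h.1 0 (by norm_num))
  obtain ⟨C₁, S₁, -, h₁⟩ := exists_bound_of_isBigO (h.1 1 (by norm_num))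
  obtain ⟨C₂, S₂, -, h₂⟩ := exists_bound_of_isBigO (h.1 2 le_rfl)
  obtain ⟨C₃, S₃, -, h₃⟩ := exists_bound_of_isBigO (h.2 0 (by norm_num))
  obtain ⟨C₄, S₄, -, h₄⟩ := exists_bound_of_isBigO (h.2 1 le_rfl)
  set C := max C₀ (max C₁ (max C₂ (max C₃ C₄))) with hC
  set R₀ := max (e.R + 1) (max 1 (max S₀ (max S₁ (max S₂ (max S₃ S₄))))) with hR₀
  -- from `‖g x‖ ≤ c |x|^p` beyond `s` to `g x ≤ C |x|^p` beyond `R₀`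
  have key : ∀ {c s : ℝ} {g : E3 → ℝ} {p : ℝ}, (∀ x : E3, s ≤ ‖x‖ → ‖g x‖ ≤ c * ‖x‖ ^ p) →
      c ≤ C → s ≤ R₀ → ∀ x : E3, R₀ ≤ ‖x‖ → g x ≤ C * ‖x‖ ^ p :=
    fun hg hc hs x hx ↦ ((Real.le_norm_self _).trans (hg x (hs.trans hx))).trans
      (mul_le_mul_of_nonneg_right hc (Real.rpow_nonneg (norm_nonneg _) _))
  refine ⟨C, R₀, by simp [hR₀], by simp [hR₀], fun m hm ↦ ?_, fun m hm ↦ ?_⟩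
  · interval_cases m
    · exact key h₀ (by simp [hC]) (by simp [hR₀])
    · exact key h₁ (by simp [hC]) (by simp [hR₀])
    · exact key h₂ (by simp [hC]) (by simp [hR₀])
  · interval_cases m
    · exact key h₃ (by simp [hC]) (by simp [hR₀])
    · exact key h₄ (by simp [hC]) (by simp [hR₀])

end AFEnd

namespace StationaryAFBlackHole

variable (𝓑 : StationaryAFBlackHole.{u})

/-! ### The causal past and future of the asymptotic region -/

/-- The chronological past `I⁻(M_ext)` of the asymptotic region (its complement is the black-hole
region, `Stationary.lean`). Chruściel–Costa, Astérisque 321 (2008), (2.2)–(2.3). [folklore] -/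
def pastOfEnd : Set 𝓑.carrier :=
  𝓑.metric.chronologicalPast 𝓑.timeOrientation 𝓑.Mext

/-- The chronological future `I⁺(M_ext)` of the asymptotic region. Chruściel–Costa, Astérisque 321
(2008), (2.2). [folklore] -/
def futureOfEnd : Set 𝓑.carrier :=
  𝓑.metric.chronologicalFuture 𝓑.timeOrientation 𝓑.Mext

/-- `⟨⟨M_ext⟩⟩ = I⁺(M_ext) ∩ I⁻(M_ext)` (by `rfl`). Chruściel–Costa 2008, (2.2). [folklore] -/
theorem doc_eq : 𝓑.doc = 𝓑.futureOfEnd ∩ 𝓑.pastOfEnd :=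
  rfl

/-- `𝓔⁺ = ∂I⁻(M_ext) ∩ I⁺(M_ext)` (by `rfl`). Chruściel–Costa 2008, (2.5). [folklore] -/
theorem horizon_eq : 𝓑.horizon = frontier 𝓑.pastOfEnd ∩ 𝓑.futureOfEnd :=
  rfl

/-- `B = M ∖ I⁻(M_ext)` (by `rfl`). Chruściel–Costa 2008, (2.3). [folklore] -/
theorem blackHoleRegion_eq : 𝓑.blackHoleRegion = 𝓑.pastOfEndᶜ :=
  rfl

/-! ### Convergence of stationary black holes: pointed `C^∞` Cheeger–Gromov convergence modulo
scale, anchored at the causal structure of the end, with uniform asymptotic flatness -/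

/-- **Convergence data exhibiting the stationary black hole `𝓑` as the limit of the sequence
`𝓑ₙ`** modulo diffeomorphisms and homotheties — the transcription, for black-hole
exteriors-with-horizon of varying underlying manifold, of pointed `C^∞` Cheeger–Gromov
convergence (Anderson, Ann. Henri Poincaré 1 (2000), §1.3, Lemma 1.3: convergence of stationary
vacuum solutions "in the `C^∞` topology, modulo diffeomorphisms", potentials renormalised by
scalars; Morgan–Tian 2007, Def. 5.3: exhaustion, embeddings `φ_k`, `φ_k^* g_k → g_∞` uniformly on
compact sets with all derivatives) requested by `defn-StationaryVacuumModuli`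
("`[𝓑ₙ] → [𝓑]` iff for an exhaustion `K₁ ⊂ K₂ ⊂ ⋯` of a `T`-invariant neighbourhood of a Cauchy
slice collar through the horizon of `𝓑` there are smooth embeddings `ψₙ : Kₙ → 𝓑ₙ` with
`ψₙ^*(gₙ, Tₙ) → (g, T)` in `C^∞_loc`, plus uniform control of the AF weighted norms of a fixed
order along the ends"). The data (pattern of `Spacetime.BlowupSequence`, `TangentProfile`):
* `W` — an open, `T`-flow-invariant neighbourhood of `⟨⟨M_ext⟩⟩ ∪ 𝓔⁺` in the limit `𝓑`, on whose
  compact subsets convergence is tested (no exhaustion is chosen: every compact subset of `W`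
  lies in some `Kₙ` and conversely, cf. the module docstring of `TangentProfile`);
* `scale = (ƛₙ > 0)` — the homothety factors ("modulo scale");
* `embed = (ψₙ : M → Mₙ)` — near every compact `C ⊆ W`, eventually a time-orientation
  preserving smooth open embedding of a neighbourhood of `C`;
* `tendsto_blowupDeviationCk` — `ƛₙ⁻² ψₙ^* gₙ → g` in `Cᵏ` for every `k`, on every compact subset
  of every local parametrisation `χ : V → W` (`Spacetime.blowupDeviationCk`);
* `tendsto_fieldDeviationCk` — `ƛₙ ψₙ^* Tₙ → T` likewise (`Spacetime.fieldDeviationCk`; the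
  factor `ƛₙ` because Killing fields normalised at infinity scale like `g^{-1/2}`);
* **anchoring** (the "pointed" in pointed convergence, replacing base points `φ_k(x_∞) = x_k`;
  cf. the centring clauses of `Spacetime.BlowupSequence`): the pulled-back pasts and futures of the
  asymptotic regions converge to those of the limit, locally uniformly off their boundaries —
  compact subsets of `W ∩ I^∓(M_ext)` are eventually mapped into `I^∓(M_ext,ₙ)`, compact subsets
  of `W ∖ closure I^∓(M_ext)` eventually into the complement; hence `ψₙ⁻¹(⟨⟨M_ext,ₙ⟩⟩) → ⟨⟨M_ext⟩⟩`,
  `ψₙ⁻¹(Bₙ) → B` and the horizons `𝓔ₙ⁺ = ∂I⁻ ∩ I⁺` accumulate only at `∂I⁻(M_ext)`;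
* `uniformlyAF` — **uniform asymptotic flatness of a fixed order `α > 0`** of the RESCALED data
  `(ƛₙ⁻² hₙ, ƛₙ⁻¹ kₙ)` read in the rescaled end charts `x' = x/ƛₙ` of the slices of the `𝓑ₙ`
  (`h'_{ij}(x') = h_{ij}(ƛₙ x')`, `k'_{ij}(x') = ƛₙ k_{ij}(ƛₙ x')`: `AFEnd.rescaleChart` applied to
  `AFEnd.hCoeff/kCoeff`; bounds `AFEnd.ChartDecayWith`):
  `|∂^m (h' − δ)(x')| ≤ C |x'|^{−α−m}` (`m ≤ 2`), `|∂^m k'(x')| ≤ C |x'|^{−α−1−m}` (`m ≤ 1`) for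
  `|x'| ≥ R₀`, with `α, C, R₀` independent of `n` (the explicit-constant form of
  `AFEnd.IsAsymptoticallyFlat … α`, Bartnik 1986, Def. 2.1), the charts being honest there
  (`eₙ.R < ƛₙ R₀`).
No field equation, regularity or convergence RATE is part of the data. [cite: Anderson2000, §1.3, Lemma 1.3] -/
structure ConvergenceData (𝓑s : ℕ → StationaryAFBlackHole.{u}) (𝓑 : StationaryAFBlackHole.{v})
    where
  /-- The open `T`-invariant neighbourhood of `⟨⟨M_ext⟩⟩ ∪ 𝓔⁺` on which convergence is tested. -/
  W : Set 𝓑.carrier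
  /-- `W` is open. -/
  isOpen_W : IsOpen W
  /-- `W ⊇ ⟨⟨M_ext⟩⟩ ∪ 𝓔⁺`. -/
  doc_union_horizon_subset_W : 𝓑.doc ∪ 𝓑.horizon ⊆ W
  /-- `W` is invariant under the flow of the stationary Killing field. -/
  isFlowInvariant_W : IsFlowInvariant 𝓑.killing W
  /-- The scales `ƛₙ`. -/
  scale : ℕ → ℝ
  /-- The scales are positive. -/
  scale_pos : ∀ n, 0 < scale n
  /-- The comparison maps `ψₙ : M → Mₙ` (embeddings near every compact subset of `W`, eventually). -/
  embed : ∀ n, 𝓑.carrier → (𝓑s n).carrier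
  /-- Near every compact `C ⊆ W`, eventually `ψₙ` is a smooth open embedding of an open
  neighbourhood `U ⊇ C` mapping the time orientation to future-directed vectors. -/
  eventually_isOpenEmbedding : ∀ C : Set 𝓑.carrier, IsCompact C → C ⊆ W → ∀ᶠ n in atTop,
    ∃ U : Opens 𝓑.carrier, C ⊆ U ∧ ContMDiffOn (𝓡 4) (𝓡 4) ∞ (embed n) U ∧
      IsOpenEmbedding ((U : Set 𝓑.carrier).restrict (embed n)) ∧
      ∀ z ∈ U, (𝓑s n).timeOrientation.IsFutureDirected
        (mfderiv (𝓡 4) (𝓡 4) (embed n) z (𝓑.timeOrientation.vectorField z))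
  /-- `ƛₙ⁻² ψₙ^* gₙ → g` in every `Cᵏ` on every compact subset of every local parametrisation of
  `W`. -/
  tendsto_blowupDeviationCk : ∀ (V : Opens E4) (χ : V → 𝓑.carrier),
    ContMDiff (𝓡 4) (𝓡 4) ∞ χ → IsOpenEmbedding χ → range χ ⊆ W → ∀ C : Set V, IsCompact C →
      ∀ k : ℕ, Tendsto (fun n ↦ Spacetime.blowupDeviationCk (𝓑s n).toSpacetime 𝓑.toSpacetime
        (embed n) (scale n) χ C k) atTop (𝓝 0)
  /-- `ƛₙ ψₙ^* Tₙ → T` in every `Cᵏ` on every compact subset of every local parametrisation of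
  `W`. -/
  tendsto_fieldDeviationCk : ∀ (V : Opens E4) (χ : V → 𝓑.carrier),
    ContMDiff (𝓡 4) (𝓡 4) ∞ χ → IsOpenEmbedding χ → range χ ⊆ W → ∀ C : Set V, IsCompact C →
      ∀ k : ℕ, Tendsto (fun n ↦ Spacetime.fieldDeviationCk (𝓑s n).toSpacetime 𝓑.toSpacetime
        (embed n) (scale n) (𝓑s n).killing 𝓑.killing χ C k) atTop (𝓝 0)
  /-- Anchoring, past, inner half: compact subsets of `W ∩ I⁻(M_ext)` are eventually mapped into
  `I⁻(M_ext,ₙ)`. -/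
  eventually_mapsTo_pastOfEnd : ∀ C : Set 𝓑.carrier, IsCompact C → C ⊆ W ∩ 𝓑.pastOfEnd →
    ∀ᶠ n in atTop, MapsTo (embed n) C (𝓑s n).pastOfEnd
  /-- Anchoring, past, outer half: compact subsets of `W ∖ closure I⁻(M_ext)` are eventually
  mapped into `Mₙ ∖ I⁻(M_ext,ₙ)` (the black-hole regions). -/
  eventually_mapsTo_pastOfEnd_compl : ∀ C : Set 𝓑.carrier, IsCompact C →
    C ⊆ W \ closure 𝓑.pastOfEnd → ∀ᶠ n in atTop, MapsTo (embed n) C (𝓑s n).pastOfEndᶜ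
  /-- Anchoring, future, inner half: compact subsets of `W ∩ I⁺(M_ext)` are eventually mapped
  into `I⁺(M_ext,ₙ)`. -/
  eventually_mapsTo_futureOfEnd : ∀ C : Set 𝓑.carrier, IsCompact C → C ⊆ W ∩ 𝓑.futureOfEnd →
    ∀ᶠ n in atTop, MapsTo (embed n) C (𝓑s n).futureOfEnd
  /-- Anchoring, future, outer half: compact subsets of `W ∖ closure I⁺(M_ext)` are eventually
  mapped into `Mₙ ∖ I⁺(M_ext,ₙ)`. -/
  eventually_mapsTo_futureOfEnd_compl : ∀ C : Set 𝓑.carrier, IsCompact C →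
    C ⊆ W \ closure 𝓑.futureOfEnd → ∀ᶠ n in atTop, MapsTo (embed n) C (𝓑s n).futureOfEndᶜ
  /-- Uniform asymptotic flatness of a fixed order `α > 0` of the rescaled data
  `(ƛₙ⁻² hₙ, ƛₙ⁻¹ kₙ)` in the rescaled end charts `x' = x/ƛₙ`, with constants independent of `n`. -/
  uniformlyAF : ∃ α C R₀ : ℝ, 0 < α ∧ 0 < R₀ ∧ (∀ n, (𝓑s n).e.R < scale n * R₀) ∧
    ∀ n, AFEnd.ChartDecayWith (AFEnd.rescaleChart (scale n) 0 (AFEnd.hCoeff (𝓑s n).e (𝓑s n).D))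
      (AFEnd.rescaleChart (scale n) 1 (AFEnd.kCoeff (𝓑s n).e (𝓑s n).D)) α C R₀

/-- **`𝓑ₙ → 𝓑` modulo diffeomorphisms and homotheties** (pointed `C^∞` Cheeger–Gromov
convergence of stationary black holes, anchored at the causal structure of the ends, with uniform
asymptotic flatness): there are `ConvergenceData`. Anderson 2000, §1.3, Lemma 1.3; Morgan–Tian
2007, Def. 5.3. [cite: Anderson2000, §1.3, Lemma 1.3] -/
def ConvergesTo (𝓑s : ℕ → StationaryAFBlackHole.{u}) (𝓑 : StationaryAFBlackHole.{v}) : Prop :=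
  Nonempty (ConvergenceData 𝓑s 𝓑)

namespace ConvergenceData

variable {𝓑s : ℕ → StationaryAFBlackHole.{u}} {𝓑 : StationaryAFBlackHole.{v}}

/-- The scales are nonzero. [folklore] -/
theorem scale_ne_zero (D : ConvergenceData 𝓑s 𝓑) (n : ℕ) : D.scale n ≠ 0 :=
  (D.scale_pos n).ne'

/-- **Subsequences** of convergence data are convergence data with the same limit
(precomposition with a strictly monotone `φ : ℕ → ℕ`). Morgan–Tian 2007, Def. 5.3.
[cite: MorganTian2007, Def. 5.3] -/
def comp (D : ConvergenceData 𝓑s 𝓑) {φ : ℕ → ℕ} (hφ : StrictMono φ) :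
    ConvergenceData (𝓑s ∘ φ) 𝓑 where
  W := D.W
  isOpen_W := D.isOpen_W
  doc_union_horizon_subset_W := D.doc_union_horizon_subset_W
  isFlowInvariant_W := D.isFlowInvariant_W
  scale := D.scale ∘ φ
  scale_pos n := D.scale_pos (φ n)
  embed n := D.embed (φ n)
  eventually_isOpenEmbedding C hC hCW :=
    hφ.tendsto_atTop.eventually (D.eventually_isOpenEmbedding C hC hCW)
  tendsto_blowupDeviationCk V χ hχ hχ' hW C hC k :=
    (D.tendsto_blowupDeviationCk V χ hχ hχ' hW C hC k).comp hφ.tendsto_atTop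
  tendsto_fieldDeviationCk V χ hχ hχ' hW C hC k :=
    (D.tendsto_fieldDeviationCk V χ hχ hχ' hW C hC k).comp hφ.tendsto_atTop
  eventually_mapsTo_pastOfEnd C hC hCP :=
    hφ.tendsto_atTop.eventually (D.eventually_mapsTo_pastOfEnd C hC hCP)
  eventually_mapsTo_pastOfEnd_compl C hC hCP :=
    hφ.tendsto_atTop.eventually (D.eventually_mapsTo_pastOfEnd_compl C hC hCP)
  eventually_mapsTo_futureOfEnd C hC hCP :=
    hφ.tendsto_atTop.eventually (D.eventually_mapsTo_futureOfEnd C hC hCP)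
  eventually_mapsTo_futureOfEnd_compl C hC hCP :=
    hφ.tendsto_atTop.eventually (D.eventually_mapsTo_futureOfEnd_compl C hC hCP)
  uniformlyAF := by
    obtain ⟨α, C, R₀, hα, hR₀, hR, hAF⟩ := D.uniformlyAF
    exact ⟨α, C, R₀, hα, hR₀, fun n ↦ hR (φ n), fun n ↦ hAF (φ n)⟩

/-- Anchoring has content: a point of `W ∩ ⟨⟨M_ext⟩⟩` is eventually mapped into `⟨⟨M_ext,ₙ⟩⟩`.
[folklore] -/
theorem eventually_mem_doc (D : ConvergenceData 𝓑s 𝓑) {z : 𝓑.carrier} (hzW : z ∈ D.W)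
    (hz : z ∈ 𝓑.doc) : ∀ᶠ n in atTop, D.embed n z ∈ (𝓑s n).doc := by
  have h1 := D.eventually_mapsTo_futureOfEnd {z} isCompact_singleton
    (singleton_subset_iff.2 ⟨hzW, hz.1⟩)
  have h2 := D.eventually_mapsTo_pastOfEnd {z} isCompact_singleton
    (singleton_subset_iff.2 ⟨hzW, hz.2⟩)
  filter_upwards [h1, h2] with n hn hn'
  exact ⟨hn (mem_singleton z), hn' (mem_singleton z)⟩

/-- Dually, a point of `W` in the interior of the black-hole region is eventually mapped into the
black-hole regions `Bₙ`. [folklore] -/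
theorem eventually_mem_blackHoleRegion (D : ConvergenceData 𝓑s 𝓑) {z : 𝓑.carrier} (hzW : z ∈ D.W)
    (hz : z ∉ closure 𝓑.pastOfEnd) : ∀ᶠ n in atTop, D.embed n z ∈ (𝓑s n).blackHoleRegion :=
  (D.eventually_mapsTo_pastOfEnd_compl {z} isCompact_singleton
    (singleton_subset_iff.2 ⟨hzW, hz⟩)).mono fun _ h ↦ h (mem_singleton z)

end ConvergenceData

/-! #### Sanity: constant sequences converge -/

namespace ConvergenceData

/-- **The constant sequence at `𝓑` converges to `𝓑`** (`W = M`, `ƛₙ = 1`, `ψₙ = id`; the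
uniform asymptotic flatness clause is the explicit-constant form of the structure field
`𝓑.isAsymptoticallyFlat`, `AFEnd.IsAsymptoticallyFlat.exists_chartDecayWith`): the structure
`ConvergenceData` is inhabited over every stationary black hole and its clauses are consistent
with the hypothesis structure `StationaryAFBlackHole`. [folklore] -/
def const (𝓑 : StationaryAFBlackHole.{u}) : ConvergenceData (fun _ ↦ 𝓑) 𝓑 where
  W := univ
  isOpen_W := isOpen_univ
  doc_union_horizon_subset_W := subset_univ _
  isFlowInvariant_W := isFlowInvariant_univ _
  scale _ := 1
  scale_pos _ := one_pos
  embed _ := id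
  eventually_isOpenEmbedding C _ _ := Eventually.of_forall fun n ↦ by
    refine ⟨⊤, fun _ _ ↦ trivial, contMDiff_id.contMDiffOn, ?_, fun z _ ↦ ?_⟩
    · exact (⊤ : Opens 𝓑.carrier).isOpen.isOpenEmbedding_subtypeVal
    · rw [mfderiv_id]
      exact 𝓑.timeOrientation.isFutureDirected_vectorField z
  tendsto_blowupDeviationCk V χ _ _ _ C _ k := by
    simp only [Spacetime.blowupDeviationCk_id_one]
    exact tendsto_const_nhds
  tendsto_fieldDeviationCk V χ _ _ _ C _ k := by
    simp only [Spacetime.fieldDeviationCk_id_one]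
    exact tendsto_const_nhds
  eventually_mapsTo_pastOfEnd C _ hCP := Eventually.of_forall fun _ z hz ↦ (hCP hz).2
  eventually_mapsTo_pastOfEnd_compl C _ hCP :=
    Eventually.of_forall fun _ z hz hz' ↦ (hCP hz).2 (subset_closure hz')
  eventually_mapsTo_futureOfEnd C _ hCP := Eventually.of_forall fun _ z hz ↦ (hCP hz).2
  eventually_mapsTo_futureOfEnd_compl C _ hCP :=
    Eventually.of_forall fun _ z hz hz' ↦ (hCP hz).2 (subset_closure hz')
  uniformlyAF := by
    obtain ⟨α, hα, hAF⟩ := 𝓑.isAsymptoticallyFlat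
    obtain ⟨C, R₀, hR, hR₀, hcd⟩ := hAF.exists_chartDecayWith
    exact ⟨α, C, R₀, hα, hR₀, fun _ ↦ by simpa using hR, fun _ ↦ by
      simpa only [AFEnd.rescaleChart_one] using hcd⟩

end ConvergenceData

/-- The constant sequence at `𝓑` converges to `𝓑`. [folklore] -/
theorem convergesTo_const (𝓑 : StationaryAFBlackHole.{u}) : ConvergesTo (fun _ ↦ 𝓑) 𝓑 :=
  ⟨ConvergenceData.const 𝓑⟩

/-- Convergence passes to subsequences. Morgan–Tian 2007, Def. 5.3. [cite: MorganTian2007, Def. 5.3] -/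
theorem ConvergesTo.comp {𝓑s : ℕ → StationaryAFBlackHole.{u}} {𝓑 : StationaryAFBlackHole.{v}}
    (h : ConvergesTo 𝓑s 𝓑) {φ : ℕ → ℕ} (hφ : StrictMono φ) : ConvergesTo (𝓑s ∘ φ) 𝓑 :=
  h.map fun D ↦ D.comp hφ

end StationaryAFBlackHole

/-! ### The topology of the moduli space -/

namespace StationaryVacuumModuli

/-- **The topology of the moduli space `𝔐`**: the sequential topology generated by pointed
`C^∞` Cheeger–Gromov convergence modulo scale of representatives — `U ⊆ 𝔐` is open iff for every
regular stationary vacuum black hole `𝓑` with `[𝓑] ∈ U` and every sequence `𝓑ₙ` of regular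
stationary vacuum black holes converging to `𝓑` (`StationaryAFBlackHole.ConvergesTo`: some
convergence data — a `T`-invariant open `W ⊇ ⟨⟨M_ext⟩⟩ ∪ 𝓔⁺`, scales, eventual embeddings with
`ƛₙ⁻² ψₙ^* gₙ → g`, `ƛₙ ψₙ^* Tₙ → T` in `C^∞_loc(W)`, anchored pasts/futures of the ends,
uniformly AF rescaled data), eventually `[𝓑ₙ] ∈ U`. It is the finest topology in which every such
sequence of classes converges to the class of its limit (`tendsto_mk_of_convergesTo`); the
convergence relation is tested on ALL representatives, so no compatibility of `ConvergesTo` with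
`ModuliEquivalence` needs to be postulated. Requested form of `defn-StationaryVacuumModuli`
("`[𝓑ₙ] → [𝓑]` iff …"); model: Anderson 2000, §1.3 (moduli space of stationary solutions,
`C^∞` convergence modulo diffeomorphisms), Anderson–Khuri, arXiv:0909.4550, §1, §3
(`𝓔_S = 𝔼_S/𝒟₁` with the quotient topology). [cite: Anderson2000, §1.3, Lemma 1.3] -/
instance topologicalSpace : TopologicalSpace StationaryVacuumModuli.{u} where
  IsOpen U := ∀ (𝓑 : StationaryAFBlackHole.{u}) (h𝓑 : 𝓑.IsRegularVacuum), mk 𝓑 h𝓑 ∈ U →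
    ∀ (𝓑s : ℕ → StationaryAFBlackHole.{u}) (h𝓑s : ∀ n, (𝓑s n).IsRegularVacuum),
      StationaryAFBlackHole.ConvergesTo 𝓑s 𝓑 → ∀ᶠ n in atTop, mk (𝓑s n) (h𝓑s n) ∈ U
  isOpen_univ _ _ _ _ _ _ := Eventually.of_forall fun _ ↦ mem_univ _
  isOpen_inter U V hU hV 𝓑 h𝓑 hm 𝓑s h𝓑s hc :=
    (hU 𝓑 h𝓑 hm.1 𝓑s h𝓑s hc).and (hV 𝓑 h𝓑 hm.2 𝓑s h𝓑s hc)
  isOpen_sUnion 𝒰 h𝒰 𝓑 h𝓑 hm 𝓑s h𝓑s hc := by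
    obtain ⟨U, hU, hmU⟩ := mem_sUnion.1 hm
    exact (h𝒰 U hU 𝓑 h𝓑 hmU 𝓑s h𝓑s hc).mono fun n hn ↦ mem_sUnion.2 ⟨U, hU, hn⟩

/-- Unfolding lemma: a set of classes is open iff it eventually contains every sequence of
classes of regular holes converging (as representatives) to a representative of one of its
points. [folklore] -/
theorem isOpen_iff {U : Set StationaryVacuumModuli.{u}} : IsOpen U ↔
    ∀ (𝓑 : StationaryAFBlackHole.{u}) (h𝓑 : 𝓑.IsRegularVacuum), mk 𝓑 h𝓑 ∈ U →
      ∀ (𝓑s : ℕ → StationaryAFBlackHole.{u}) (h𝓑s : ∀ n, (𝓑s n).IsRegularVacuum),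
        StationaryAFBlackHole.ConvergesTo 𝓑s 𝓑 → ∀ᶠ n in atTop, mk (𝓑s n) (h𝓑s n) ∈ U :=
  Iff.rfl

/-- **Convergent sequences of representatives give convergent sequences of classes**:
if `𝓑ₙ → 𝓑` (`ConvergesTo`) then `[𝓑ₙ] → [𝓑]` in `𝔐`. [folklore] -/
theorem tendsto_mk_of_convergesTo {𝓑s : ℕ → StationaryAFBlackHole.{u}} {𝓑 : StationaryAFBlackHole.{u}}
    (h𝓑s : ∀ n, (𝓑s n).IsRegularVacuum) (h𝓑 : 𝓑.IsRegularVacuum)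
    (h : StationaryAFBlackHole.ConvergesTo 𝓑s 𝓑) :
    Tendsto (fun n ↦ mk (𝓑s n) (h𝓑s n)) atTop (𝓝 (mk 𝓑 h𝓑)) := by
  rw [tendsto_nhds]
  exact fun U hU hmU ↦ hU 𝓑 h𝓑 hmU 𝓑s h𝓑s h

/-- A set of classes is closed iff it contains the class of the limit of every convergent
sequence of regular holes whose classes it frequently contains. [folklore] -/
theorem isClosed_iff {F : Set StationaryVacuumModuli.{u}} : IsClosed F ↔
    ∀ (𝓑 : StationaryAFBlackHole.{u}) (h𝓑 : 𝓑.IsRegularVacuum)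
      (𝓑s : ℕ → StationaryAFBlackHole.{u}) (h𝓑s : ∀ n, (𝓑s n).IsRegularVacuum),
      StationaryAFBlackHole.ConvergesTo 𝓑s 𝓑 → (∃ᶠ n in atTop, mk (𝓑s n) (h𝓑s n) ∈ F) →
        mk 𝓑 h𝓑 ∈ F := by
  rw [← isOpen_compl_iff, isOpen_iff]
  constructor
  · intro h 𝓑 h𝓑 𝓑s h𝓑s hc hF
    by_contra hm
    exact (h 𝓑 h𝓑 hm 𝓑s h𝓑s hc).and_frequently hF |>.exists.elim fun n hn ↦ hn.1 hn.2
  · intro h 𝓑 h𝓑 hm 𝓑s h𝓑s hc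
    by_contra hne
    rw [not_eventually] at hne
    exact hm (h 𝓑 h𝓑 𝓑s h𝓑s hc (hne.mono fun n hn ↦ not_notMem.1 hn))

/-! ### The Kerr locus -/

/-- **`m ∈ 𝔐` is the Kerr point of angular-momentum ratio `χ = a/M`**: `m` is the class of a
regular stationary vacuum black hole which is equivalent, modulo isometry of `T`-invariant
neighbourhoods of `⟨⟨M_ext⟩⟩ ∪ 𝓔⁺` intertwining the Killing fields and homothety
(`ModuliEquivalence`), to the sub-extremal Kerr black hole `Kerr.stationaryAFBlackHole M a δ`
(`KerrStationaryBlackHole.lean`: the ingoing Kerr–Schild chart `{r > r₊ − δ}`, `0 < δ < r₊ − r₋`,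
with Killing field `∂_{t*}`) for some `M > |a|` with `a = χ M`. Only the Kerr chart's d.o.c.,
horizon, metric and Killing field enter (through `ModuliEquivalence`), not its slice `{t* = 0}`
(which is not a Cauchy hypersurface of that chart): the regular representative is `𝓑`, so nothing is
presupposed about Kerr being regular. `±a` give the same point (`φ ↦ −φ`). Instance hypotheses
`[Kerr.Facts] [Kerr.SliceFacts]` and the named fact `Kerr.isAsymptoticallyFlat_data`
(existentially: a false fact would only empty the locus) as in `Kerr.stationaryAFBlackHole`.
Expected, NOT asserted: for `|χ| < 1` the fibre `{m | IsKerrPoint m χ}` is a singleton of level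
`χ²/(1 + √(1 − χ²))² = a²/r₊²` (route `FinalStateConjecture/SignedCensus`, NUMBERS). O'Neill 1995,
Ch. 2; Dafermos–Rodnianski arXiv:0811.0354, §5.1. [cite: arXiv08110354, §5.1] -/
def IsKerrPoint [Kerr.Facts] [Kerr.SliceFacts] (m : StationaryVacuumModuli.{0}) (χ : ℝ) : Prop :=
  ∃ (𝓑 : StationaryAFBlackHole.{0}) (h𝓑 : 𝓑.IsRegularVacuum) (M a δ : ℝ)
    (hMa : Kerr.IsSubextremal M a) (hAF : Kerr.isAsymptoticallyFlat_data M a (Kerr.rPlus M a - δ)),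
    mk 𝓑 h𝓑 = m ∧ a = χ * M ∧ 0 < δ ∧ δ < Kerr.rPlus M a - Kerr.rMinus M a ∧
      𝓑.IsModuliEquivalent (Kerr.stationaryAFBlackHole M a δ hMa hAF)

/-- The **Kerr locus** of `𝔐`: the classes of regular holes equivalent to some sub-extremal Kerr
black hole (the image of the Kerr curve `χ = a/M ∈ (−1, 1)`, `χ ∼ −χ`). [cite: arXiv08110354, §5.1] -/
def kerrLocus [Kerr.Facts] [Kerr.SliceFacts] : Set StationaryVacuumModuli.{0} :=
  {m | ∃ χ : ℝ, IsKerrPoint m χ}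

/-- A Kerr point has ratio `|χ| < 1` (sub-extremality `|a| < M`, `a = χ M`). [folklore] -/
theorem IsKerrPoint.abs_lt_one [Kerr.Facts] [Kerr.SliceFacts] {m : StationaryVacuumModuli.{0}}
    {χ : ℝ} (h : IsKerrPoint m χ) : |χ| < 1 := by
  obtain ⟨_, _, M, a, _, hMa, _, _, ha, -⟩ := h
  have hM : 0 < M := hMa.pos
  have h1 : |a| < M := hMa
  rw [ha, abs_mul, abs_of_pos hM] at h1
  by_contra hcon
  push Not at hcon
  nlinarith

/-- Membership in the Kerr locus unfolds to `IsKerrPoint` for some ratio. [folklore] -/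
theorem mem_kerrLocus_iff [Kerr.Facts] [Kerr.SliceFacts] {m : StationaryVacuumModuli.{0}} :
    m ∈ kerrLocus ↔ ∃ χ : ℝ, IsKerrPoint m χ :=
  Iff.rfl

/-- The expected level of the Kerr point of ratio `χ = a/M`: `a²/r₊² = χ²/(1 + √(1 − χ²))²`
(`r₊ = M + √(M² − a²)`), strictly increasing from `0` (Schwarzschild) to `1` (extremality) on
`[0, 1)`. A closed-form NUMBER of route `FinalStateConjecture/SignedCensus` (its NUMBERS section);
that `level m = kerrRatioLevel χ` for `IsKerrPoint m χ` is a statement about `g(∂_{t*}, ∂_{t*})`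
on `{r = r₊}`, NOT asserted here. [folklore] -/
def kerrRatioLevel (χ : ℝ) : ℝ :=
  χ ^ 2 / (1 + Real.sqrt (1 - χ ^ 2)) ^ 2

/-- `kerrRatioLevel 0 = 0` (Schwarzschild: `T` is null on the horizon). [folklore] -/
@[simp]
theorem kerrRatioLevel_zero : kerrRatioLevel 0 = 0 := by
  simp [kerrRatioLevel]

/-- `kerrRatioLevel χ = a²/r₊²` for `a = χ M`, `M > 0`, `|χ| ≤ 1` (`Kerr.rPlus M a = M + √(M² − a²)`).
[folklore] -/
theorem kerrRatioLevel_eq {M χ : ℝ} (hM : 0 < M) (hχ : |χ| ≤ 1) :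
    kerrRatioLevel χ = (χ * M) ^ 2 / Kerr.rPlus M (χ * M) ^ 2 := by
  have h1 : M ^ 2 - (χ * M) ^ 2 = M ^ 2 * (1 - χ ^ 2) := by ring
  have hχ2 : 0 ≤ 1 - χ ^ 2 := by nlinarith [abs_nonneg χ, sq_abs χ]
  rw [kerrRatioLevel, Kerr.rPlus, h1, Real.sqrt_mul (sq_nonneg M), Real.sqrt_sq hM.le]
  have hden : (1 + Real.sqrt (1 - χ ^ 2)) ≠ 0 := by positivity
  field_simp

end StationaryVacuumModuli

end Literature.Geometry.Lorentzian

end
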